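import Summits.KontsevichZagierPeriods.KontsevichZagierPeriods.Theses.IsogenyCertificates
import Summits.KontsevichZagierPeriods.KontsevichZagierPeriods.Theorems.IsogenyCertificatesXMapPeriodTransferStubCellMonotone
import Summits.KontsevichZagierPeriods.KontsevichZagierPeriods.Theorems.IsogenyCertificatesXMapPeriodTransferStubCellEnds
import Summits.KontsevichZagierPeriods.KontsevichZagierPeriods.Theorems.IsogenyCertificatesXMapPeriodTransferStubIntervalImage

/-!
# `EffectiveXMapChains` (stmt-KontsevichZagierPeriods-10664), line `full-component-sheets` —
stub `stub_pieceOntoComponent` (the full-sheet lemma)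

For a COPRIME x-rational isogeny datum `(f, g, c)` between `y² = P(x) = x³ + Ax + B` and
`y² = P'(x) = x³ + A'x + B'` (`W = f'g − fg' ≠ 0`, `c²·g·(f³ + A'fg² + B'g³) = P·W²`), on every PIECE
(connected component of the sheet set `S = {P > 0, g ≠ 0, W ≠ 0}`) the x-map `R = f/g` is injective
and maps the piece ONTO a whole connected component of `{P' > 0}`.

Proof (glue over the sibling crux `XMapPeriodTransfer`'s landed cell analysis, namespace
`…IsogenyCertificates.XMapPeriodTransferCells`): the sheet set IS the cell locus
`L = {P > 0, W ≠ 0}` (`g ≠ 0` is automatic there, `cellMonotone_noPole`); `stub_cellMonotone` gives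
strict (anti)monotonicity of `R` on the cell — hence injectivity — its shape `(p, ∞)` or `(p, q)`
with `P·W = 0` at the finite ends, and `P'(R) > 0`; `stub_cellEnds` gives the end limits (a root of
`P'`, or `|R| → ∞`) at such ends and at `+∞`; `stub_intervalImage` turns this into
`R(cell) = (u, ∞)` or `(u, v)` with `u < v` roots of `P'`; and an open interval inside `{P' > 0}`
whose finite ends are roots of `P'` is the connected component of `{P' > 0}` through any of its
points (`component_eq_of_Ioi`, `component_eq_of_Ioo`). No nonsingularity hypothesis is needed.

References: M. Kontsevich, D. Zagier, *Periods* (2001), §1.2 (rule (2)); L. C. Washington,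
*Elliptic Curves* (2008), §2.9.
-/

noncomputable section

open Set Filter Polynomial Topology
open Summit.KontsevichZagierPeriods.IsogenyCertificates.XMapPeriodTransferCells

namespace Summit.KontsevichZagierPeriods.IsogenyCertificates.EffectiveXMapChainsLine

namespace PieceOntoComponent

/-- The sheet set `{P > 0, g ≠ 0, W ≠ 0}` of a datum IS the cell locus `{P > 0, W ≠ 0}`: on the
latter `g ≠ 0` is forced by the certificate identity. [folklore] -/
theorem sheetSet_eq_cellLocus {A B A' B' : ℤ} {f g : ℚ[X]} {c : ℚ}
    (hI : C (c ^ 2) * g * (f ^ 3 + C (A' : ℚ) * f * g ^ 2 + C (B' : ℚ) * g ^ 3) =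
      (X ^ 3 + C (A : ℚ) * X + C (B : ℚ)) * (derivative f * g - f * derivative g) ^ 2) :
    {x : ℝ | 0 < x ^ 3 + (A : ℝ) * x + (B : ℝ) ∧ aeval x g ≠ 0 ∧
        aeval x (derivative f * g - f * derivative g) ≠ 0} =
      {y : ℝ | 0 < y ^ 3 + (A : ℝ) * y + (B : ℝ) ∧
        aeval y (derivative f * g - f * derivative g) ≠ 0} := by
  ext x
  constructor
  · rintro ⟨h1, -, h3⟩
    exact ⟨h1, h3⟩
  · rintro ⟨h1, h3⟩
    exact ⟨h1, cellMonotone_noPole hI h1 h3, h3⟩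

/-- An open ray `(u, ∞)` inside a set `F ⊆ ℝ` whose end `u` is not in `F` is the connected component
of `F` through each of its points. [folklore] -/
theorem component_eq_of_Ioi {F : Set ℝ} {u y : ℝ} (hu : u ∉ F) (hsub : Ioi u ⊆ F) (hy : y ∈ Ioi u) :
    connectedComponentIn F y = Ioi u := by
  apply Subset.antisymm
  · intro z hz
    by_contra hzu
    have hzu' : z ≤ u := not_lt.mp hzu
    have hoc : OrdConnected (connectedComponentIn F y) :=
      isPreconnected_iff_ordConnected.mp isPreconnected_connectedComponentIn
    have huK : u ∈ connectedComponentIn F y :=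
      hoc.out hz (mem_connectedComponentIn (hsub hy)) ⟨hzu', le_of_lt hy⟩
    exact hu (connectedComponentIn_subset _ _ huK)
  · exact isPreconnected_Ioi.subset_connectedComponentIn hy hsub

/-- An open interval `(u, v)` inside a set `F ⊆ ℝ` whose ends are not in `F` is the connected
component of `F` through each of its points. [folklore] -/
theorem component_eq_of_Ioo {F : Set ℝ} {u v y : ℝ} (hu : u ∉ F) (hv : v ∉ F) (hsub : Ioo u v ⊆ F)
    (hy : y ∈ Ioo u v) : connectedComponentIn F y = Ioo u v := by
  apply Subset.antisymm
  · intro z hz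
    have hoc : OrdConnected (connectedComponentIn F y) :=
      isPreconnected_iff_ordConnected.mp isPreconnected_connectedComponentIn
    have hyK : y ∈ connectedComponentIn F y := mem_connectedComponentIn (hsub hy)
    by_contra hzI
    rcases not_and_or.mp hzI with h | h
    · have hzu : z ≤ u := not_lt.mp h
      have huK : u ∈ connectedComponentIn F y := hoc.out hz hyK ⟨hzu, le_of_lt hy.1⟩
      exact hu (connectedComponentIn_subset _ _ huK)
    · have hvz : v ≤ z := not_lt.mp h
      have hvK : v ∈ connectedComponentIn F y := hoc.out hyK hz ⟨le_of_lt hy.2, hvz⟩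
      exact hv (connectedComponentIn_subset _ _ hvK)
  · exact isPreconnected_Ioo.subset_connectedComponentIn hy hsub

/-- A root of `P'` is not in `{P' > 0}`. [folklore] -/
theorem root_not_mem {A' B' : ℤ} {u : ℝ} (hu : u ^ 3 + (A' : ℝ) * u + (B' : ℝ) = 0) :
    u ∉ {y : ℝ | 0 < y ^ 3 + (A' : ℝ) * y + (B' : ℝ)} := by
  intro h
  have h' : 0 < u ^ 3 + (A' : ℝ) * u + (B' : ℝ) := h
  rw [hu] at h'
  exact lt_irrefl _ h'

/-- `(p, ∞) ≠ (p, q)`. [folklore] -/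
theorem Ioi_ne_Ioo (p q : ℝ) : Ioi p ≠ Ioo p q := by
  intro h
  have hm : max p q + 1 ∈ Ioi p := by
    show p < max p q + 1
    linarith [le_max_left p q]
  rw [h] at hm
  linarith [hm.2, le_max_right p q]

end PieceOntoComponent

open PieceOntoComponent

/-- **Stub `stub_pieceOntoComponent` (full sheets: every piece maps onto a whole component).** For a
COPRIME datum, on the connected component (piece) of the sheet set `S = {P > 0, g ≠ 0, W ≠ 0}`
through `t`, the x-map `R = f/g` is injective and its image is exactly the connected component of
`{P' > 0}` through `R t` (interior: `P'(R) = P·W²/(c²g⁴) > 0`; critical values, finite boundary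
values and `R(±∞)` are roots of `P'`; poles go to `+∞`). [cite: KontsevichZagier2001, §1.2 rule (2)] -/
theorem stub_pieceOntoComponent (A B A' B' : ℤ) (f g : ℚ[X]) (c : ℚ) (hcop : IsCoprime f g) (hW : derivative f * g - f * derivative g ≠ 0) (hI : C (c ^ 2) * g * (f ^ 3 + C (A' : ℚ) * f * g ^ 2 + C (B' : ℚ) * g ^ 3) = (X ^ 3 + C (A : ℚ) * X + C (B : ℚ)) * (derivative f * g - f * derivative g) ^ 2) (t : ℝ) (ht : t ∈ {x : ℝ | 0 < x ^ 3 + (A : ℝ) * x + (B : ℝ) ∧ aeval x g ≠ 0 ∧ aeval x (derivative f * g - f * derivative g) ≠ 0}) : Set.InjOn (fun x : ℝ => aeval x f / aeval x g) (connectedComponentIn {x : ℝ | 0 < x ^ 3 + (A : ℝ) * x + (B : ℝ) ∧ aeval x g ≠ 0 ∧ aeval x (derivative f * g - f * derivative g) ≠ 0} t) ∧ (fun x : ℝ => aeval x f / aeval x g) '' connectedComponentIn {x : ℝ | 0 < x ^ 3 + (A : ℝ) * x + (B : ℝ) ∧ aeval x g ≠ 0 ∧ aeval x (derivative f * g - f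 * derivative g) ≠ 0} t = connectedComponentIn {y : ℝ | 0 < y ^ 3 + (A' : ℝ) * y + (B' : ℝ)} (aeval t f / aeval t g) := by
  -- the sheet set is the cell locus `L`
  rw [sheetSet_eq_cellLocus hI]
  set L : Set ℝ := {y : ℝ | 0 < y ^ 3 + (A : ℝ) * y + (B : ℝ) ∧
    aeval y (derivative f * g - f * derivative g) ≠ 0} with hL
  set F' : Set ℝ := {y : ℝ | 0 < y ^ 3 + (A' : ℝ) * y + (B' : ℝ)} with hF'
  set R : ℝ → ℝ := fun x => aeval x f / aeval x g with hR
  have htL : t ∈ L := by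
    have h := ht
    rw [sheetSet_eq_cellLocus hI] at h
    exact h
  -- cell structure and monotonicity
  obtain ⟨hloc, hmono, p, hpt, hpW, hshape⟩ := stub_cellMonotone A B A' B' f g c hW hI R
    (fun y => aeval y (derivative f * g - f * derivative g)) L rfl rfl rfl t htL
  set K : Set ℝ := connectedComponentIn L t with hK
  have htK : t ∈ K := mem_connectedComponentIn htL
  refine ⟨hmono.elim StrictMonoOn.injOn StrictAntiOn.injOn, ?_⟩
  -- end limits (coprime datum)
  obtain ⟨hends, hinfty⟩ := stub_cellEnds A B A' B' f g c hW hI hcop R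
    (fun y => aeval y (derivative f * g - f * derivative g)) rfl rfl
  -- hypotheses of the interval-image lemma
  have hcont : ContinuousOn R K := fun x hx => (hloc x hx).2.2.continuousAt.continuousWithinAt
  have hsubF' : R '' K ⊆ F' := by
    rintro _ ⟨x, hx, rfl⟩
    exact (hloc x hx).2.1
  have hC : K = Ioi p ∨ ∃ q : ℝ, p < q ∧ K = Ioo p q := by
    rcases hshape with h | ⟨q, htq, -, h⟩
    · exact Or.inl h
    · exact Or.inr ⟨q, hpt.trans htq, h⟩
  have hleft : (∃ ℓ : ℝ, ℓ ^ 3 + (A' : ℝ) * ℓ + (B' : ℝ) = 0 ∧ Tendsto R (𝓝[>] p) (𝓝 ℓ)) ∨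
      Tendsto (fun x => |R x|) (𝓝[>] p) atTop := by
    rcases hends p hpW with ⟨ℓ, hℓ, h⟩ | h
    · exact Or.inl ⟨ℓ, hℓ, h.mono_left (nhdsGT_le_nhdsNE p)⟩
    · exact Or.inr (h.mono_left (nhdsGT_le_nhdsNE p))
  have hright : ∀ q : ℝ, K = Ioo p q →
      (∃ ℓ : ℝ, ℓ ^ 3 + (A' : ℝ) * ℓ + (B' : ℝ) = 0 ∧ Tendsto R (𝓝[<] q) (𝓝 ℓ)) ∨
        Tendsto (fun x => |R x|) (𝓝[<] q) atTop := by
    intro q hq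
    rcases hshape with h | ⟨q', htq', hq'W, h⟩
    · exact absurd (h.symm.trans hq) (Ioi_ne_Ioo p q)
    · have hqq : q' = q := by
        have e : Ioo p q' = Ioo p q := h.symm.trans hq
        have h1 : p < q' := hpt.trans htq'
        have htq : t ∈ Ioo p q := by rw [← hq]; exact htK
        have h2 : p < q := htq.1.trans htq.2
        have := csSup_Ioo h1
        rw [e, csSup_Ioo h2] at this
        exact this.symm
      subst hqq
      rcases hends q' hq'W with ⟨ℓ, hℓ, h⟩ | h
      · exact Or.inl ⟨ℓ, hℓ, h.mono_left (nhdsLT_le_nhdsNE q')⟩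
      · exact Or.inr (h.mono_left (nhdsLT_le_nhdsNE q'))
  have hinf : K = Ioi p →
      (∃ ℓ : ℝ, ℓ ^ 3 + (A' : ℝ) * ℓ + (B' : ℝ) = 0 ∧ Tendsto R atTop (𝓝 ℓ)) ∨
        Tendsto (fun x => |R x|) atTop atTop := fun _ => hinfty
  obtain ⟨u, hu, himg⟩ := stub_intervalImage A' B' R K p hC hcont hmono hsubF' hleft hright hinf
  -- identify the image with the component of `{P' > 0}` through `R t`
  have hRt : R t ∈ R '' K := mem_image_of_mem R htK
  rcases himg with h | ⟨v, hv, _, h⟩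
  · rw [h] at hRt hsubF' ⊢
    exact (component_eq_of_Ioi (root_not_mem hu) hsubF' hRt).symm
  · rw [h] at hRt hsubF' ⊢
    exact (component_eq_of_Ioo (root_not_mem hu) (root_not_mem hv) hsubF' hRt).symm

end Summit.KontsevichZagierPeriods.IsogenyCertificates.EffectiveXMapChainsLine

end
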